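import Mathlib
import Summits.Ventures.PercRepro2.GcBundleConn

/-!
# Three-terminal parts: connectivity through a part is the partition of its terminals
(blind cell PercRepro2, night-3 g29, 2026-08-29; `proofs/NIGHT3-CERT.md` §38 — the connectivity half of
the gadget-law method of §36.2, in the cell's cluster vocabulary)

A **three-terminal part** (`IsPart ends W t₁ t₂ t₃`) is a vertex set `W` with three terminals
`t₁, t₂, t₃ ∉ W` such that every edge touching `W` has both ends in `W ∪ {t₁, t₂, t₃}` — typer-1's root
bundle (`Bundle.IsBundle`, `GcBundleConn.lean`) with the terminals arbitrary and NO admissibility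
condition: all five partitions of the terminals may occur.  For the edge set `S = touches ends W` and
three chosen edges `e₁, e₂, e₃` of `S`:

* **`partEnds ends S e₁ e₂ e₃ t₁ t₂ t₃`** — the incidence map with `e₁` re-wired to `{t₁, t₂}`, `e₂` to
  `{t₁, t₃}`, `e₃` to `{t₂, t₃}` (the three VIRTUAL edges) and every other edge of `S` a loop at `t₁`;
* **`partMap S e₁ e₂ e₃ α β γ ω`** — `ω` with its coordinates on `S` replaced by the three pattern
  observables `α = blockObs ends S t₁ t₂`, `β = blockObs ends S t₁ t₃`, `γ = blockObs ends S t₂ t₃`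
  («`tᵢ ↔ tⱼ` inside `S`», `Block.blockObs`) at the virtual edges and `false` elsewhere on `S`;
* **`conn_part_iff`** — for two vertices `x, z ∉ W`: `x ↔ z` in the original graph under `ω` iff `x ↔ z`
  in the part graph under the part map.  Both directions are closure arguments
  (`SepPair.mem_of_conn_of_closed'`, after typer-1): a walk of the original graph crosses `W` only
  between terminals, and a crossing joins two terminals inside `S` — the open virtual edge; a walk
  of the part graph uses a virtual edge only when its ends are joined inside `S`.

So an unmarked part enters every connection event among vertices outside it only through the partition
of its terminals it induces — the statement the gadget-law method (§36.2) rests on.  Own work (the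
proof follows `Bundle.conn_bundle_iff`); standard axioms.
-/

namespace Summit.Ventures.PercRepro2

open SepPair Block

namespace Part

/-! ## The part and its collapsed incidence map -/

section Defs

variable {V : Type*} {E : Type*} [DecidableEq E]

/-- **A three-terminal part**: the terminals are outside `W`, and every edge touching `W` has both
of its ends in `W ∪ {t₁, t₂, t₃}`. -/
structure IsPart (ends : E → Sym2 V) (W : Set V) (t₁ t₂ t₃ : V) : Prop where
  /-- `t₁ ∉ W` -/
  t₁_notMem : t₁ ∉ W
  /-- `t₂ ∉ W` -/
  t₂_notMem : t₂ ∉ W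
  /-- `t₃ ∉ W` -/
  t₃_notMem : t₃ ∉ W
  /-- every edge touching `W` has both ends in `W ∪ {t₁, t₂, t₃}` -/
  ends_mem : ∀ e ∈ touches ends W, ∀ x y, ends e = s(x, y) →
    (x ∈ W ∨ x = t₁ ∨ x = t₂ ∨ x = t₃) ∧ (y ∈ W ∨ y = t₁ ∨ y = t₂ ∨ y = t₃)

/-- **The part graph**: `e₁` is re-wired to `{t₁, t₂}`, `e₂` to `{t₁, t₃}`, `e₃` to `{t₂, t₃}`, every
other edge of `S` becomes a loop at `t₁`, the edges outside `S` are unchanged. -/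
def partEnds (ends : E → Sym2 V) (S : Set E) [DecidablePred (· ∈ S)] (e₁ e₂ e₃ : E)
    (t₁ t₂ t₃ : V) : E → Sym2 V :=
  fun e => if e = e₁ then s(t₁, t₂) else if e = e₂ then s(t₁, t₃) else if e = e₃ then s(t₂, t₃)
    else if e ∈ S then s(t₁, t₁) else ends e

/-- **The part map**: `ω` with its coordinates on `S` replaced by `α ω` at `e₁`, `β ω` at `e₂`,
`γ ω` at `e₃`, `false` elsewhere on `S`. -/
def partMap (S : Set E) [DecidablePred (· ∈ S)] (e₁ e₂ e₃ : E) (α β γ : Config E → Bool)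
    (ω : Config E) : Config E :=
  fun e => if e = e₁ then α ω else if e = e₂ then β ω else if e = e₃ then γ ω
    else if e ∈ S then false else ω e

variable (ends : E → Sym2 V) (S : Set E) [DecidablePred (· ∈ S)] {e₁ e₂ e₃ : E} (t₁ t₂ t₃ : V)

/-- `partEnds` at `e₁`. -/
lemma partEnds_apply_1 : partEnds ends S e₁ e₂ e₃ t₁ t₂ t₃ e₁ = s(t₁, t₂) := by
  simp [partEnds]

/-- `partEnds` at `e₂ ≠ e₁`. -/
lemma partEnds_apply_2 (h12 : e₁ ≠ e₂) : partEnds ends S e₁ e₂ e₃ t₁ t₂ t₃ e₂ = s(t₁, t₃) := by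
  simp [partEnds, h12.symm]

/-- `partEnds` at `e₃ ≠ e₁, e₂`. -/
lemma partEnds_apply_3 (h13 : e₁ ≠ e₃) (h23 : e₂ ≠ e₃) :
    partEnds ends S e₁ e₂ e₃ t₁ t₂ t₃ e₃ = s(t₂, t₃) := by
  simp [partEnds, h13.symm, h23.symm]

/-- `partEnds` on an edge of `S` other than the virtual edges: a loop. -/
lemma partEnds_apply_of_mem {e : E} (h1 : e ≠ e₁) (h2 : e ≠ e₂) (h3 : e ≠ e₃) (he : e ∈ S) :
    partEnds ends S e₁ e₂ e₃ t₁ t₂ t₃ e = s(t₁, t₁) := by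
  simp [partEnds, h1, h2, h3, he]

/-- `partEnds` on an edge outside `S` (the virtual edges lie in `S`): unchanged. -/
lemma partEnds_apply_of_notMem (h1 : e₁ ∈ S) (h2 : e₂ ∈ S) (h3 : e₃ ∈ S) {e : E} (he : e ∉ S) :
    partEnds ends S e₁ e₂ e₃ t₁ t₂ t₃ e = ends e := by
  have k1 : e ≠ e₁ := fun h => he (h ▸ h1)
  have k2 : e ≠ e₂ := fun h => he (h ▸ h2)
  have k3 : e ≠ e₃ := fun h => he (h ▸ h3)
  simp [partEnds, k1, k2, k3, he]

variable {ends t₁ t₂ t₃} (α β γ : Config E → Bool) (ω : Config E)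

/-- `partMap` at `e₁`. -/
lemma partMap_apply_1 : partMap S e₁ e₂ e₃ α β γ ω e₁ = α ω := by
  simp [partMap]

/-- `partMap` at `e₂ ≠ e₁`. -/
lemma partMap_apply_2 (h12 : e₁ ≠ e₂) : partMap S e₁ e₂ e₃ α β γ ω e₂ = β ω := by
  simp [partMap, h12.symm]

/-- `partMap` at `e₃ ≠ e₁, e₂`. -/
lemma partMap_apply_3 (h13 : e₁ ≠ e₃) (h23 : e₂ ≠ e₃) : partMap S e₁ e₂ e₃ α β γ ω e₃ = γ ω := by
  simp [partMap, h13.symm, h23.symm]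

/-- `partMap` on an edge of `S` other than the virtual edges: closed. -/
lemma partMap_apply_of_mem {e : E} (h1 : e ≠ e₁) (h2 : e ≠ e₂) (h3 : e ≠ e₃) (he : e ∈ S) :
    partMap S e₁ e₂ e₃ α β γ ω e = false := by
  simp [partMap, h1, h2, h3, he]

/-- `partMap` on an edge outside `S` (the virtual edges lie in `S`): unchanged. -/
lemma partMap_apply_of_notMem (h1 : e₁ ∈ S) (h2 : e₂ ∈ S) (h3 : e₃ ∈ S) {e : E} (he : e ∉ S) :
    partMap S e₁ e₂ e₃ α β γ ω e = ω e := by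
  have k1 : e ≠ e₁ := fun h => he (h ▸ h1)
  have k2 : e ≠ e₂ := fun h => he (h ▸ h2)
  have k3 : e ≠ e₃ := fun h => he (h ▸ h3)
  simp [partMap, k1, k2, k3, he]

end Defs

/-! ## Connectivity through the part -/

section Conn

variable {V : Type*} {E : Type*} [DecidableEq E]

/-- **The crossing of the part**: two distinct terminals joined inside `S` are joined in the part graph
under the part map (by the open virtual edge). -/
lemma conn_part_of_terminals {ends : E → Sym2 V} {S : Set E} [DecidablePred (· ∈ S)]
    {e₁ e₂ e₃ : E} (h12 : e₁ ≠ e₂) (h13 : e₁ ≠ e₃) (h23 : e₂ ≠ e₃) {t₁ t₂ t₃ : V}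
    {ends' : E → Sym2 V} (hends' : ends' = partEnds ends S e₁ e₂ e₃ t₁ t₂ t₃) {ω ω' : Config E}
    (hω' : ω' = partMap S e₁ e₂ e₃ (blockObs ends S t₁ t₂) (blockObs ends S t₁ t₃)
      (blockObs ends S t₂ t₃) ω)
    {t t' : V} (ht : t = t₁ ∨ t = t₂ ∨ t = t₃) (ht' : t' = t₁ ∨ t' = t₂ ∨ t' = t₃) (hne : t ≠ t')
    (hc : Conn ends (restrictTo S ω) t t') : Conn ends' ω' t t' := by
  -- the three virtual edges, when open
  have h1 : Conn ends (restrictTo S ω) t₁ t₂ → Conn ends' ω' t₁ t₂ := by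
    intro h
    have hopen : ω' e₁ = true := by
      rw [hω', partMap_apply_1, blockObs_eq_true_iff]
      exact h
    have hend : ends' e₁ = s(t₁, t₂) := by rw [hends', partEnds_apply_1]
    exact conn_of_openAdj ⟨e₁, hopen, hend⟩
  have h2 : Conn ends (restrictTo S ω) t₁ t₃ → Conn ends' ω' t₁ t₃ := by
    intro h
    have hopen : ω' e₂ = true := by
      rw [hω', partMap_apply_2 S _ _ _ ω h12, blockObs_eq_true_iff]
      exact h
    have hend : ends' e₂ = s(t₁, t₃) := by rw [hends', partEnds_apply_2 ends S t₁ t₂ t₃ h12]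
    exact conn_of_openAdj ⟨e₂, hopen, hend⟩
  have h3 : Conn ends (restrictTo S ω) t₂ t₃ → Conn ends' ω' t₂ t₃ := by
    intro h
    have hopen : ω' e₃ = true := by
      rw [hω', partMap_apply_3 S _ _ _ ω h13 h23, blockObs_eq_true_iff]
      exact h
    have hend : ends' e₃ = s(t₂, t₃) := by rw [hends', partEnds_apply_3 ends S t₁ t₂ t₃ h13 h23]
    exact conn_of_openAdj ⟨e₃, hopen, hend⟩
  rcases ht with rfl | rfl | rfl <;> rcases ht' with rfl | rfl | rfl
  · exact absurd rfl hne
  · exact h1 hc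
  · exact h2 hc
  · exact conn_symm (h1 (conn_symm hc))
  · exact absurd rfl hne
  · exact h3 hc
  · exact conn_symm (h2 (conn_symm hc))
  · exact conn_symm (h3 (conn_symm hc))
  · exact absurd rfl hne

/-- **Connectivity is carried by the collapse (from the original graph)**: if `x ↔ z` under `ω` with
`x, z ∉ W`, then `x ↔ z` in the part graph under the part map. -/
lemma conn_part_of_conn {ends : E → Sym2 V} {W : Set V} {t₁ t₂ t₃ : V}
    (hW : IsPart ends W t₁ t₂ t₃) {S : Set E} [DecidablePred (· ∈ S)]
    (hS : ∀ e, e ∈ S ↔ e ∈ touches ends W) {e₁ e₂ e₃ : E} (h1 : e₁ ∈ S) (h2 : e₂ ∈ S) (h3 : e₃ ∈ S)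
    (h12 : e₁ ≠ e₂) (h13 : e₁ ≠ e₃) (h23 : e₂ ≠ e₃)
    {ends' : E → Sym2 V} (hends' : ends' = partEnds ends S e₁ e₂ e₃ t₁ t₂ t₃) {ω ω' : Config E}
    (hω' : ω' = partMap S e₁ e₂ e₃ (blockObs ends S t₁ t₂) (blockObs ends S t₁ t₃)
      (blockObs ends S t₂ t₃) ω)
    {x z : V} (hx : x ∉ W) (hz : z ∉ W) (h : Conn ends ω x z) : Conn ends' ω' x z := by
  have hterm : ∀ t, (t = t₁ ∨ t = t₂ ∨ t = t₃) → t ∉ W := by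
    rintro t (rfl | rfl | rfl)
    · exact hW.t₁_notMem
    · exact hW.t₂_notMem
    · exact hW.t₃_notMem
  -- the closure set
  let T : Set V := {y | (y ∉ W ∧ Conn ends' ω' x y) ∨
    (y ∈ W ∧ ∃ t, (t = t₁ ∨ t = t₂ ∨ t = t₃) ∧ Conn ends' ω' x t ∧ Conn ends (restrictTo S ω) t y)}
  have hxT : x ∈ T := Or.inl ⟨hx, conn_refl _ _ _⟩
  have hclosed : ∀ e y y', ω e = true → ends e = s(y, y') → y ∈ T → y' ∈ T := by
    intro e y y' he hends hy
    by_cases heS : e ∈ S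
    · -- an edge of the part: both ends in `W ∪ {t₁, t₂, t₃}`, open inside `S`
      obtain ⟨hy1, hy'1⟩ := hW.ends_mem e ((hS e).1 heS) y y' hends
      have heS' : restrictTo S ω e = true := restrictTo_eq_true_of_mem heS he
      have hadj : Conn ends (restrictTo S ω) y y' := conn_of_openAdj ⟨e, heS', hends⟩
      -- the terminal reaching `y`, and the connection `t ↔ y'` inside `S`
      obtain ⟨t, ht, hxt, hty'⟩ : ∃ t, (t = t₁ ∨ t = t₂ ∨ t = t₃) ∧ Conn ends' ω' x t ∧
          Conn ends (restrictTo S ω) t y' := by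
        rcases hy with ⟨hyW, hxy⟩ | ⟨hyW, t, ht, hxt, hty⟩
        · rcases hy1 with hyW' | ht
          · exact absurd hyW' hyW
          · exact ⟨y, ht, hxy, hadj⟩
        · exact ⟨t, ht, hxt, conn_trans hty hadj⟩
      rcases hy'1 with hy'W | ht'
      · exact Or.inr ⟨hy'W, t, ht, hxt, hty'⟩
      · have hy'W : y' ∉ W := hterm y' ht'
        by_cases htt : t = y'
        · subst htt
          exact Or.inl ⟨hy'W, hxt⟩
        · exact Or.inl ⟨hy'W, conn_trans hxt
            (conn_part_of_terminals h12 h13 h23 hends' hω' ht ht' htt hty')⟩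
    · -- an edge outside the part: unchanged in the collapse, both ends outside `W`
      have hyW : y ∉ W := fun hw => heS ((hS e).2 (mem_touches_of_ends hends (Or.inl hw)))
      have hy'W : y' ∉ W := fun hw => heS ((hS e).2 (mem_touches_of_ends hends (Or.inr hw)))
      have hxy : Conn ends' ω' x y := by
        rcases hy with ⟨_, hxy⟩ | ⟨hyW', _⟩
        · exact hxy
        · exact absurd hyW' hyW
      have hopen : ω' e = true := by
        rw [hω', partMap_apply_of_notMem S _ _ _ ω h1 h2 h3 heS]
        exact he
      have hend : ends' e = s(y, y') := by
        rw [hends', partEnds_apply_of_notMem ends S t₁ t₂ t₃ h1 h2 h3 heS]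
        exact hends
      exact Or.inl ⟨hy'W, conn_trans hxy (conn_of_openAdj ⟨e, hopen, hend⟩)⟩
  have hzT : z ∈ T := mem_of_conn_of_closed' hclosed hxT h
  rcases hzT with ⟨_, hxz⟩ | ⟨hzW, _⟩
  · exact hxz
  · exact absurd hzW hz

/-- **Connectivity is carried by the collapse (to the original graph)**: if `x ↔ z` in the part graph
under the part map, then `x ↔ z` under `ω`. -/
lemma conn_of_conn_part {ends : E → Sym2 V} {S : Set E} [DecidablePred (· ∈ S)] {e₁ e₂ e₃ : E}
    (h1 : e₁ ∈ S) (h2 : e₂ ∈ S) (h3 : e₃ ∈ S) (h12 : e₁ ≠ e₂) (h13 : e₁ ≠ e₃) (h23 : e₂ ≠ e₃)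
    {t₁ t₂ t₃ : V} {ends' : E → Sym2 V} (hends' : ends' = partEnds ends S e₁ e₂ e₃ t₁ t₂ t₃)
    {ω ω' : Config E}
    (hω' : ω' = partMap S e₁ e₂ e₃ (blockObs ends S t₁ t₂) (blockObs ends S t₁ t₃)
      (blockObs ends S t₂ t₃) ω)
    {x z : V} (h : Conn ends' ω' x z) : Conn ends ω x z := by
  let T : Set V := {y | Conn ends ω x y}
  have hxT : x ∈ T := conn_refl _ _ _
  have hclosed : ∀ e y y', ω' e = true → ends' e = s(y, y') → y ∈ T → y' ∈ T := by
    intro e y y' he hends hy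
    by_cases he1 : e = e₁
    · -- the virtual edge `{t₁, t₂}`: open only when `t₁ ↔ t₂` inside `S`
      subst he1
      have hc : Conn ends (restrictTo S ω) t₁ t₂ := by
        rw [hω', partMap_apply_1, blockObs_eq_true_iff] at he
        exact he
      have hc' : Conn ends ω t₁ t₂ := conn_of_conn_restrictTo hc
      rw [hends', partEnds_apply_1, Sym2.eq_iff] at hends
      rcases hends with ⟨rfl, rfl⟩ | ⟨rfl, rfl⟩
      · exact conn_trans hy hc'
      · exact conn_trans hy (conn_symm hc')
    · by_cases he2 : e = e₂
      · -- the virtual edge `{t₁, t₃}`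
        subst he2
        have hc : Conn ends (restrictTo S ω) t₁ t₃ := by
          rw [hω', partMap_apply_2 S _ _ _ ω h12, blockObs_eq_true_iff] at he
          exact he
        have hc' : Conn ends ω t₁ t₃ := conn_of_conn_restrictTo hc
        rw [hends', partEnds_apply_2 ends S t₁ t₂ t₃ h12, Sym2.eq_iff] at hends
        rcases hends with ⟨rfl, rfl⟩ | ⟨rfl, rfl⟩
        · exact conn_trans hy hc'
        · exact conn_trans hy (conn_symm hc')
      · by_cases he3 : e = e₃
        · -- the virtual edge `{t₂, t₃}`
          subst he3
          have hc : Conn ends (restrictTo S ω) t₂ t₃ := by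
            rw [hω', partMap_apply_3 S _ _ _ ω h13 h23, blockObs_eq_true_iff] at he
            exact he
          have hc' : Conn ends ω t₂ t₃ := conn_of_conn_restrictTo hc
          rw [hends', partEnds_apply_3 ends S t₁ t₂ t₃ h13 h23, Sym2.eq_iff] at hends
          rcases hends with ⟨rfl, rfl⟩ | ⟨rfl, rfl⟩
          · exact conn_trans hy hc'
          · exact conn_trans hy (conn_symm hc')
        · by_cases heS : e ∈ S
          · rw [hω', partMap_apply_of_mem S _ _ _ ω he1 he2 he3 heS] at he
            exact absurd he Bool.false_ne_true
          · rw [hω', partMap_apply_of_notMem S _ _ _ ω h1 h2 h3 heS] at he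
            rw [hends', partEnds_apply_of_notMem ends S t₁ t₂ t₃ h1 h2 h3 heS] at hends
            exact conn_trans hy (conn_of_openAdj ⟨e, he, hends⟩)
  exact mem_of_conn_of_closed' hclosed hxT h

/-- **Connectivity through a three-terminal part**: for `x, z ∉ W`, `x ↔ z` in the original graph under
`ω` iff `x ↔ z` in the part graph under the part map. -/
theorem conn_part_iff {ends : E → Sym2 V} {W : Set V} {t₁ t₂ t₃ : V}
    (hW : IsPart ends W t₁ t₂ t₃) {S : Set E} [DecidablePred (· ∈ S)]
    (hS : ∀ e, e ∈ S ↔ e ∈ touches ends W) {e₁ e₂ e₃ : E} (h1 : e₁ ∈ S) (h2 : e₂ ∈ S) (h3 : e₃ ∈ S)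
    (h12 : e₁ ≠ e₂) (h13 : e₁ ≠ e₃) (h23 : e₂ ≠ e₃) {ω : Config E} {x z : V} (hx : x ∉ W)
    (hz : z ∉ W) :
    Conn ends ω x z ↔ Conn (partEnds ends S e₁ e₂ e₃ t₁ t₂ t₃)
      (partMap S e₁ e₂ e₃ (blockObs ends S t₁ t₂) (blockObs ends S t₁ t₃) (blockObs ends S t₂ t₃) ω)
      x z :=
  ⟨conn_part_of_conn hW hS h1 h2 h3 h12 h13 h23 rfl rfl hx hz,
    conn_of_conn_part h1 h2 h3 h12 h13 h23 rfl rfl⟩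

end Conn

end Part

end Summit.Ventures.PercRepro2
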